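import Summits.Ventures.Crystal3D.Theorems.StickyWulffConstantGenericWallFloorBarlowOrientedGlueOneSidedAt
import Summits.Ventures.Crystal3D.Theorems.StickyWulffConstantGenericWallFloorBarlowLineCountOneSidedTilt
import HarnessLib

/-!
# F4 glue for ONE up-presented plate, CHOSEN slot, STEERED vertical `z` (‖z − e₃‖ ≤ 1/4), clause (i) alone — K1b / EDGE-ON option (ε), brick 5c
# (lane T crux `TextureLiminfV5`, stmt-Ventures-23912, sub-crux EDGE-ON `stub_edgeOn`; HOME/wall-p2-g11/EPSILON-SIZING.md)

HONEST FRAMING. Venture `Summits/Ventures/Crystal3D` (cell `crystal3d-full`), route `route-Ventures-StickyWulffConstant`, helper `--supports` the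
law-v5 crux `TextureLiminfV5` (stmt-Ventures-23912), registered line `TexShadow` v8.3, open stub `stub_edgeOn` (K4).  Rung credit only; F-C1 not moved; NOT
the stub.  Inputs BY NAME: E1 (`ExactOnly`), `DoubleStarCoaxialAt` / `CapPairCoaxial`.

Tilt port of `barlow_hlines_oriented_oneSided_at` (…BarlowOrientedGlueOneSidedAt, K1a chosen-slot glue): the bottom plate is presented up along `e₃`
(`0 ≤ (L₁⁻¹e₃)₂`), the launch slot `v` (a reference upper slot) is steep FOR THE STEERING `z` (`⟪L₁ v, z⟫ ≥ √2/2`, so plates with no `e₃`-steep slot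
but an up-slot of `e₃`-rise ≥ 0.51 launch), the ∇-steps are the `z`-best cappers `basalMirror (bestCapper G₁ (L₁e₃) z)` whose `e₃`-rise is assumed
`≥ 1/4` on ∇-bilayers (`hrq`, vacuous for a Δ-only word; engine-checked per box; the Δ-step rises `≥ 9/20` by `slot_e3_rise_of_tilt`), and `hapart₁` is clause (i) for `chainFrames z L₁ v`.
Output = the shape wulff-p2's generic glue `bilayerWallAt_of_lineCount_oneSided_up` consumes: a step sequence with `IsUpBond` on every bilayer,
`= v` on Δ-bilayers, `= basalMirror (bestCapper G₁ (L₁e₃) z)` on ∇-bilayers, every step rising `≥ 1/4` in `e₃`, and the cell line count with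
`C_w = 270 + 576R₀` (margin `m = 15 + 8h + 32R₀`: tilt drift `8`).
* `isUpBond_machineStep_at_steer` — machine steps with a chosen Δ-slot and the `z`-capper are `e₃`-upward bonds;
* **`barlow_hlines_oriented_oneSided_at_tilt`**.
WHAT THIS IS NOT: not the T-side cell inequality (one line from `bilayerWallAt_of_lineCount_oneSided_up`, next file with the certificate);
not the `axisSign = −1` presentation; F-C1 not moved.
-/

noncomputable section

namespace Summit.Ventures.Crystal3D.Theorems

open Finset
open Literature.MathematicalPhysics.StatisticalMechanics
open Summit.Ventures.Crystal3D.Cruxes.TextureLiminf.TexShadow (stacking cyl upSlot₁ upSlot₂ upSlot₃ bilayerRise)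
open scoped InnerProductSpace

section Oriented

variable (σ : ℤ → ℤ) (L : EuclideanSpace ℝ (Fin 3) ≃ₗᵢ[ℝ] EuclideanSpace ℝ (Fin 3)) (e z v : EuclideanSpace ℝ (Fin 3))
  (ms : ℤ → EuclideanSpace ℝ (Fin 3))

/-- **Machine steps with a CHOSEN Δ-slot and the `z`-best ∇-capper are e-upward bonds** (`IsUpBond`, orientation `axisSign = +1`). -/
theorem isUpBond_machineStep_at_steer (hσ : IsHaggSeq σ) (hax : 0 ≤ (L.symm e) 2)
    (hv : v ∈ fccSlots) (hv2 : v 2 = Real.sqrt (2 / 3))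
    (hms₁ : ∀ m, σ m = 1 → ms m = v)
    (hms₂ : ∀ m, σ m = -1 → ms m =
      basalMirror (bestCapper (twinFrame L (L (EuclideanSpace.single (2 : Fin 3) (1 : ℝ)))) (L (EuclideanSpace.single (2 : Fin 3) (1 : ℝ))) z))
    (m : ℤ) : IsUpBond L σ e m (ms m) := by
  have hax1 : axisSign L e = 1 := by simp [axisSign, hax]
  rcases hσ m with hm | hm
  · rcases eq_upSlot_of_apply_two hv hv2 with h | h | h
    · exact ⟨0, 0, Or.inl ⟨rfl, rfl⟩, by rw [hms₁ m hm, h, hax1, one_smul, if_pos hm]; rfl⟩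
    · exact ⟨-1, 0, Or.inr (Or.inl ⟨rfl, rfl⟩), by rw [hms₁ m hm, h, hax1, one_smul, if_pos hm]; rfl⟩
    · exact ⟨0, -1, Or.inr (Or.inr ⟨rfl, rfl⟩), by rw [hms₁ m hm, h, hax1, one_smul, if_pos hm]; rfl⟩
  · obtain ⟨hq, hq2⟩ := bestCapper_nabla_slot L z
    have hm' : ¬ σ m = 1 := by rw [hm]; decide
    have hneg := eq_upSlot_of_apply_two (neg_mem_fccSlots hq) (by simp [hq2])
    have key : ∀ w : EuclideanSpace ℝ (Fin 3),
        -bestCapper (twinFrame L (L (EuclideanSpace.single (2 : Fin 3) (1 : ℝ)))) (L (EuclideanSpace.single (2 : Fin 3) (1 : ℝ))) z = w →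
        ms m = axisSign L e • (if σ m = 1 then w else basalMirror (-w)) := by
      intro w hw
      rw [hms₂ m hm, hax1, one_smul, if_neg hm', ← hw, neg_neg]
    rcases hneg with h | h | h
    · exact ⟨0, 0, Or.inl ⟨rfl, rfl⟩, key _ h⟩
    · exact ⟨-1, 0, Or.inr (Or.inl ⟨rfl, rfl⟩), key _ h⟩
    · exact ⟨0, -1, Or.inr (Or.inr ⟨rfl, rfl⟩), key _ h⟩

end Oriented

open scoped Classical in
/-- **F4 glue for ONE up-presented plate, chosen slot `v` steep for the steering `z`, clause (i) only.**  See the module docstring. -/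
theorem barlow_hlines_oriented_oneSided_at_tilt
    {sE : EuclideanSpace ℝ (Fin 3)} (hsE : sE ∈ fccSlots) (hcert : ExactOnly 0 (fccSlots.filter fun w => 0 < ⟪w, sE⟫_ℝ))
    (hDS : ∀ F₁ F₂ : EuclideanSpace ℝ (Fin 3) ≃ₗᵢ[ℝ] EuclideanSpace ℝ (Fin 3), DoubleStarCoaxialAt F₁ F₂) (hCP : CapPairCoaxial)
    {σ₁ σ₂ : ℤ → ℤ} (hσ₁ : IsHaggSeq σ₁) (hσ₂ : IsHaggSeq σ₂)
    (L₁ L₂ : EuclideanSpace ℝ (Fin 3) ≃ₗᵢ[ℝ] EuclideanSpace ℝ (Fin 3)) (s₁ s₂ : EuclideanSpace ℝ (Fin 3))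
    (hax₁ : 0 ≤ (L₁.symm (EuclideanSpace.single (2 : Fin 3) (1 : ℝ))) 2)
    {z : EuclideanSpace ℝ (Fin 3)} (hz : ‖z‖ = 1) (hze : ‖z - EuclideanSpace.single (2 : Fin 3) (1 : ℝ)‖ ≤ 1 / 4)
    {v : EuclideanSpace ℝ (Fin 3)} (hv : v ∈ fccSlots) (hv2 : v 2 = Real.sqrt (2 / 3))
    (hsteep₁ : Real.sqrt 2 / 2 ≤ ⟪L₁ v, z⟫_ℝ)
    (hrq : ∀ m, σ₁ m = -1 → (1 / 4 : ℝ) ≤ ⟪L₁ (basalMirror (bestCapper (twinFrame L₁ (L₁ (EuclideanSpace.single (2 : Fin 3) (1 : ℝ))))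
      (L₁ (EuclideanSpace.single (2 : Fin 3) (1 : ℝ))) z)), EuclideanSpace.single (2 : Fin 3) (1 : ℝ)⟫_ℝ)
    (hapart₁ : ∀ F ∈ chainFrames z L₁ v,
      F '' fccStacking 1 (Real.sqrt (2 / 3)) ≠ L₂ '' fccStacking 1 (Real.sqrt (2 / 3)) ∧
      F '' fccStacking 1 (Real.sqrt (2 / 3)) ≠
        (twinFrame L₂ (L₂ (EuclideanSpace.single (2 : Fin 3) (1 : ℝ)))) '' fccStacking 1 (Real.sqrt (2 / 3)))
    (R₀ : ℝ) (hR₀ : 6 ≤ R₀) :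
    ∃ step₁ : ℤ → EuclideanSpace ℝ (Fin 3),
      (∀ k, IsUpBond L₁ σ₁ (EuclideanSpace.single (2 : Fin 3) (1 : ℝ)) k (step₁ k)) ∧
      (∀ k, σ₁ k = 1 → step₁ k = v) ∧
      (∀ k, σ₁ k = -1 → step₁ k = basalMirror (bestCapper (twinFrame L₁ (L₁ (EuclideanSpace.single (2 : Fin 3) (1 : ℝ))))
        (L₁ (EuclideanSpace.single (2 : Fin 3) (1 : ℝ))) z)) ∧
      (∀ k, (1 / 4 : ℝ) ≤ ⟪step₁ k, L₁.symm (EuclideanSpace.single (2 : Fin 3) (1 : ℝ))⟫_ℝ) ∧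
      ∀ h : ℝ, 0 ≤ h → ∀ ρ : ℝ, R₀ ≤ ρ → ∀ X P₁ P₂ : Finset (EuclideanSpace ℝ (Fin 3)),
      (∀ p ∈ X, ∀ q ∈ X, p ≠ q → 1 ≤ dist p q) → P₁ ⊆ X → P₂ ⊆ X \ P₁ → (∀ p ∈ X, p ∈ cyl R₀ h ρ) →
      (∀ p, p ∈ P₁ ↔ (p ∈ stacking L₁ s₁ σ₁ ∧ -(2 * R₀) ≤ p 2 ∧ p 2 ≤ -R₀ ∧ p 0 ^ 2 + p 1 ^ 2 ≤ ρ ^ 2)) →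
      (∀ p, p ∈ P₂ ↔ (p ∈ stacking L₂ s₂ σ₂ ∧ h + R₀ ≤ p 2 ∧ p 2 ≤ h + 2 * R₀ ∧ p 0 ^ 2 + p 1 ^ 2 ≤ ρ ^ 2)) →
      ∃ (m : ℝ) (T₁ : Finset (Fin 2 → ℤ)), 0 ≤ m ∧
        (∀ t : Fin 2 → ℤ, (∃ k : ℤ,
          -R₀ - 4 ≤ (L₁ (zigVertexS step₁ k + ((t 0 : ℝ) • triangularVec₁ 1 + (t 1 : ℝ) • triangularVec₂ 1)) + s₁) 2 ∧
          (L₁ (zigVertexS step₁ k + ((t 0 : ℝ) • triangularVec₁ 1 + (t 1 : ℝ) • triangularVec₂ 1)) + s₁) 2 ≤ -R₀ - 3 ∧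
          Real.sqrt ((L₁ (zigVertexS step₁ k + ((t 0 : ℝ) • triangularVec₁ 1 + (t 1 : ℝ) • triangularVec₂ 1)) + s₁) 0 ^ 2 +
            (L₁ (zigVertexS step₁ k + ((t 0 : ℝ) • triangularVec₁ 1 + (t 1 : ℝ) • triangularVec₂ 1)) + s₁) 1 ^ 2) ≤ ρ - m) →
          t ∈ T₁) ∧
        (T₁.card : ℝ) + 18 * m * ρ ≤
          (∑ y ∈ X.filter (fun y => (X.filter fun q => dist y q = 1).card ≠ 12 ∧ -R₀ - 2 ≤ y 2 ∧ y 2 ≤ h + R₀ + 2),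
            ((12 : ℝ) - ((X.filter fun q => dist y q = 1).card : ℝ))) + (270 + 576 * R₀) * (1 + h) * ρ := by
  set e₃ : EuclideanSpace ℝ (Fin 3) := EuclideanSpace.single (2 : Fin 3) (1 : ℝ) with he₃
  have he₃n : ‖e₃‖ = 1 := by rw [he₃, PiLp.norm_single, norm_one]
  -- the ∇ slot, machine steps, canonical states
  set G₁ := twinFrame L₁ (L₁ e₃) with hG₁
  set q₁ := bestCapper G₁ (L₁ e₃) z with hq₁
  set ms₁ : ℤ → EuclideanSpace ℝ (Fin 3) := fun m => if σ₁ m = 1 then v else basalMirror q₁ with hms₁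
  set canon₁ : ℤ → EuclideanSpace ℝ (Fin 3) → EuclideanSpace ℝ (Fin 3) × List WalkEntry :=
    fun m t => if σ₁ (m - 1) = 1 then (t, [⟨L₁, v, 0⟩]) else (t, [⟨G₁, q₁, L₁ e₃⟩, ⟨L₁, v, 0⟩]) with hcanon₁
  have hne : ¬ ((-1 : ℤ) = 1) := by decide
  have hms₁₁ : ∀ m, σ₁ m = 1 → ms₁ m = v := fun m hm => by simp only [hms₁, hm, if_true]
  have hms₁₂ : ∀ m, σ₁ m = -1 → ms₁ m = basalMirror q₁ := fun m hm => by simp only [hms₁, hm, hne, if_false]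
  have hcanon₁₁ : ∀ m t, σ₁ (m - 1) = 1 → canon₁ m t = (t, [⟨L₁, v, 0⟩]) := fun m t hm => by simp only [hcanon₁, hm, if_true]
  have hcanon₁₂ : ∀ m t, σ₁ (m - 1) = -1 → canon₁ m t = (t, [⟨G₁, q₁, L₁ e₃⟩, ⟨L₁, v, 0⟩]) := fun m t hm => by
    simp only [hcanon₁, hm, hne, if_false]
  have hup : ∀ k, IsUpBond L₁ σ₁ e₃ k (ms₁ k) := isUpBond_machineStep_at_steer σ₁ L₁ e₃ z v ms₁ hσ₁ hax₁ hv hv2 hms₁₁ hms₁₂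
  -- rise floor 1/4 in `e₃` on both bilayer signs: Δ by the tilt (a z-steep slot rises ≥ 9/20), ∇ by `hrq`
  have hδ₁ : ∀ m, (1 / 4 : ℝ) ≤ ⟪L₁ (ms₁ m), e₃⟫_ℝ := by
    intro m
    rcases hσ₁ m with hm | hm
    · rw [hms₁₁ m hm]
      have h := slot_e3_rise_of_tilt hze L₁ hv hsteep₁
      linarith
    · rw [hms₁₂ m hm]; exact hrq m hm
  have hr : ∀ k, (1 / 4 : ℝ) ≤ ⟪ms₁ k, L₁.symm e₃⟫_ℝ := fun k => by rw [← inner_map_eq_inner_symm]; exact hδ₁ k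
  refine ⟨ms₁, hup, hms₁₁, hms₁₂, hr, ?_⟩
  intro h hh ρ hρ X P₁ P₂ hX hP₁X hP₂X' hcyl hP₁ hP₂
  have hP₂X : P₂ ⊆ X := hP₂X'.trans Finset.sdiff_subset
  have hcell : ∀ p ∈ X, -(2 * R₀) ≤ p 2 ∧ p 2 ≤ h + 2 * R₀ ∧ p 0 ^ 2 + p 1 ^ 2 ≤ ρ ^ 2 := fun p hp => by
    have := hcyl p hp; simpa only [cyl, Set.mem_setOf_eq] using this
  -- the polyline
  have hsucc₁ : ∀ k, zigVertexS ms₁ (k + 1) = zigVertexS ms₁ k + ms₁ k := fun k => zigVertexS_succ ms₁ k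
  have hlayer₁ : ∀ k, zigVertexS ms₁ k ∈ barlowLayer 1 (Real.sqrt (2 / 3)) σ₁ k :=
    zigVertexS_mem_barlowLayer_of_upBond L₁ hσ₁ e₃ hax₁ hup
  -- the line count with explicit margin
  have hq : (1 : ℝ) / 4 > 0 := by norm_num
  obtain ⟨T₁, hT₁, hcount⟩ := barlow_lineCount_le_payers_oneSided_tilt hX hsE hcert hDS hCP hσ₁ hσ₂ L₁ L₂ s₁ s₂ R₀ h ρ hR₀ hh
    (by linarith) P₁ P₂ hP₁X hP₂X hcell hP₁ hP₂ hz hze v canon₁ ms₁ hv hv2 hsteep₁ hcanon₁₁ hcanon₁₂ hms₁₁ hms₁₂ hq hδ₁ hapart₁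
    (zigVertexS ms₁) hsucc₁ hlayer₁
  set m : ℝ := 3 + 8 * (h + 4 * R₀) + 3 / (1 / 4) with hm
  have hmval : m = 15 + 8 * h + 32 * R₀ := by rw [hm]; ring
  have hm0 : 0 ≤ m := by rw [hmval]; nlinarith
  have hρ0 : 0 ≤ ρ := by linarith
  refine ⟨m, T₁, hm0, hT₁, ?_⟩
  have hpen : 18 * m * ρ ≤ (270 + 576 * R₀) * (1 + h) * ρ := by
    rw [hmval]
    have h1 : 18 * (15 + 8 * h + 32 * R₀) ≤ (270 + 576 * R₀) * (1 + h) := by nlinarith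
    exact mul_le_mul_of_nonneg_right h1 hρ0
  linarith

end Summit.Ventures.Crystal3D.Theorems

end
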